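import Literature.AlgebraicGeometry.Motives.FrobeniusSemisimpleIffSelfProductStrongTate
import Literature.AlgebraicGeometry.Motives.KunnethProjectorsAbelianVarieties
import Literature.AlgebraicGeometry.Motives.TateConjectureExtremeCodimensions
import HarnessLib

/-!
# Frobenius acts semisimply on `H^*(A)` as soon as it does on `H¹(A)` (Milne 2007 §1: «It follows
# that they act semisimply on all the cohomology groups `Hⁱ(A) ≃ ⋀ⁱ H¹(A)`»)

Topic `Literature/AlgebraicGeometry/Motives`; THEOREMS ONLY (no definition, no instance, no named
fact; D-0026).

J. S. Milne, *The Tate conjecture over finite fields (AIM talk)*, arXiv:0709.3040 (held, p. 3):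
«Weil proved that, for an abelian variety `A` over `𝔽`, the Frobenius maps act semisimply on
`H^1(A, ℚ_ℓ)`. It follows that they act semisimply on all the cohomology groups
`H^i(A, ℚ_ℓ) ≃ ⋀^i H^1(A, ℚ_ℓ)`. In particular, Conjecture `S(X)` holds when `X` is an abelian variety
over `𝔽`.»  T. Y. Lam, *A First Course in Noncommutative Rings* §2 (held, chunk p0038 L13): «(2.2)
Remark. Any submodule (resp., quotient module) of a semisimple R-module is semisimple.»

For the tree's abstract Galois Weil cohomology `E : GaloisWeilCohomology k K χ` and an abelian
variety `A` (`Motives.AbelianVariety`, smooth projective of dimension `g`), `H^*(A)` is generated by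
`H¹(A)`: the cup product `H¹(A) ⊗ Hᵉ(A) → Hᵉ⁺¹(A)` is SURJECTIVE (`WeilCohomology.range_mulOne`,
`Motives/AbelianVarietyWeights`, from the Hopf-algebra structure — Kleiman 1968 App. 2A, Mumford
§15) and `Hᵈ(A) ≅ ⋀ᵈ H¹(A)` (`Motives/AbelianVarietyExterior`). This file proves the «It follows»:

* §1 (pure, namespace `Literature.LinearAlgebra`) **QUOTIENTS** — Lam (2.2) for operators: if
  `e ∘ f = g ∘ e` with `e : M → N` SURJECTIVE and `f` semisimple then `g` is semisimple
  (`isSemisimple_of_comp_eq_of_surjective`: an `f`-stable complement of `Ker e` maps isomorphically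
  and equivariantly onto `N`).
* §2 **DEGREE `0` AND TOP DEGREE** (any smooth projective `X`, any `g ∈ Γ_k`): `Γ_k` acts trivially
  on `H⁰(X)` (`ρ_zero_eq_one`, from the tree's `ρTwist_zero_apply`) and through `χ(g)^{-n}` on
  `H^{2n}(X)` (`ρ_top_eq_smul_one`), hence semisimply (`isSemisimple_ρ_zero ∕ _top`).
* §3 **ABELIAN VARIETIES**: the cup product intertwines `ρ(g) ⊗ ρ(g)` with `ρ(g)` (`ρ_comp_mulOne`);
  `SS(H¹(A)) ∧ SS(Hᵉ(A)) ⟹ SS(Hᵉ⁺¹(A))` (`isSemisimple_ρ_succ_abelianVariety`) and by induction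
  **`SS(H¹(A)) ⟹ SS(Hᵈ(A))` for all `d`** (`isSemisimple_ρ_abelianVariety_of_one`), also for products
  `A × B` (`isSemisimple_ρ_prod_abelianVariety_of_one`, Künneth, row g38-#2).
* §4 **FROBENIUS** (`k` finite): `SS(H¹(A)) ⟹` Frobenius semisimple on all of `H^*(A)`, `H^*(A × A)`,
  hence «Conjecture `S(X)` holds» for `X = A` and `X = A × A` in every degree and twist
  (`ker_inf_range_eq_bot_abelianVariety_of_one`, `…_self_product_abelianVariety_of_one`, row g38-#3),
  and the self-product strong Tate condition `S^g(A × A)` (`self_product_strongTate_abelianVariety_of_one`).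
  Weil's theorem `SS(H¹(A))` itself (semisimplicity of `ℚ[π] ⊆ End⁰(A)`) is the hypothesis `h1`
  here: the axioms of `E` do not relate `E.ρ` on `H¹(A)` to `End(A)`.

## Provenance

Lane `lit-hodgefound` (summit `HodgeConjecture`, Track 2 foundations library, Layer B: motives),
seat `lit-hodgefound-p29` (literature-prover, generation 38, row g38-#4).
-/

universe u v

open CategoryTheory AlgebraicGeometry MonoidalCategory CartesianMonoidalCategory
open scoped TensorProduct

noncomputable section

/-! ## §1 (pure) Semisimplicity passes to equivariant quotients -/

namespace Literature.LinearAlgebra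

variable {R : Type*} [CommRing R] {M : Type*} [AddCommGroup M] [Module R M]
  {N : Type*} [AddCommGroup N] [Module R N]

/-- The kernel of an intertwiner `e : M → N`, `e ∘ f = g ∘ e`, is `f`-invariant.
[cite: Lam2001FirstCourse, §2 Remark (2.2) (chunk p0038 L13)] -/
theorem ker_mem_invtSubmodule_of_comp_eq {f : Module.End R M} {g : Module.End R N}
    {e : M →ₗ[R] N} (hcomm : e ∘ₗ f = g ∘ₗ e) : LinearMap.ker e ∈ f.invtSubmodule := by
  rw [Module.End.mem_invtSubmodule]
  intro x hx
  rw [Submodule.mem_comap, LinearMap.mem_ker, ← LinearMap.comp_apply, hcomm, LinearMap.comp_apply,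
    LinearMap.mem_ker.mp hx, map_zero]

/-- **Lam (2.2) for operators, quotients: an operator onto which a semisimple operator maps
equivariantly is semisimple.** If `e ∘ f = g ∘ e` with `e : M → N` surjective and `f` semisimple,
then `g` is semisimple: an `f`-stable complement `q` of `Ker e` (semisimplicity of `f`) maps
bijectively onto `N`, intertwining `f|q` with `g`. [cite: Lam2001FirstCourse, §2 Remark (2.2) (chunk p0038 L13)]
[cite: HoffmanKunze1971LinearAlgebra, §7.5 Definition (chunk p0221 L3)] -/
theorem isSemisimple_of_comp_eq_of_surjective {f : Module.End R M} (hf : f.IsSemisimple)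
    {g : Module.End R N} {e : M →ₗ[R] N} (he : Function.Surjective e)
    (hcomm : e ∘ₗ f = g ∘ₗ e) : g.IsSemisimple := by
  have hp := ker_mem_invtSubmodule_of_comp_eq hcomm
  obtain ⟨q, hq, hc⟩ := Module.End.isSemisimple_iff.mp hf _ hp
  -- `e|q : q → N` is a bijective intertwiner of `f|q` with `g`
  set e' : ↥q →ₗ[R] N := e ∘ₗ q.subtype with he'_def
  have hbij : Function.Bijective e' := by
    constructor
    · intro x y hxy
      apply Subtype.ext
      have h₁ : (x : M) - y ∈ LinearMap.ker e := by
        rw [LinearMap.mem_ker, map_sub, sub_eq_zero]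
        exact hxy
      have hmem : (x : M) - y ∈ LinearMap.ker e ⊓ q := Submodule.mem_inf.mpr ⟨h₁, q.sub_mem x.2 y.2⟩
      rw [hc.inf_eq_bot, Submodule.mem_bot, sub_eq_zero] at hmem
      exact hmem
    · intro z
      obtain ⟨m, rfl⟩ := he z
      obtain ⟨a, ha, b, hb, hab⟩ := Submodule.mem_sup.mp (hc.sup_eq_top.symm ▸ Submodule.mem_top : m ∈ LinearMap.ker e ⊔ q)
      refine ⟨⟨b, hb⟩, ?_⟩
      change e b = e m
      rw [← hab, map_add, LinearMap.mem_ker.mp ha, zero_add]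
  have hcomm' : g ∘ₗ e' = e' ∘ₗ f.restrict hq := by
    refine LinearMap.ext fun x ↦ ?_
    change g (e x) = e (f x)
    rw [← LinearMap.comp_apply, ← hcomm, LinearMap.comp_apply]
  exact (isSemisimple_iff_of_comp_eq_of_bijective hbij hcomm').mp (hf.restrict hq)

/-- Both directions together: along a bijective intertwiner written as `e ∘ f = g ∘ e`.
[cite: HoffmanKunze1971LinearAlgebra, §7.5 Definition (chunk p0221 L3)] -/
theorem isSemisimple_iff_of_comp_eq_of_bijective' {f : Module.End R M} {g : Module.End R N}
    {e : M →ₗ[R] N} (he : Function.Bijective e) (hcomm : e ∘ₗ f = g ∘ₗ e) :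
    f.IsSemisimple ↔ g.IsSemisimple :=
  ⟨fun hf ↦ isSemisimple_of_comp_eq_of_surjective hf he.2 hcomm,
    fun hg ↦ isSemisimple_of_comp_eq_of_injective hg he.1 hcomm.symm⟩

end Literature.LinearAlgebra

namespace Literature.AlgebraicGeometry.Motives

open Literature.LinearAlgebra

namespace GaloisWeilCohomology

variable {k : Type u} [Field k] {K : Type v} [Field K] [CharZero K]
  {χ : Field.absoluteGaloisGroup k →* Kˣ} (E : GaloisWeilCohomology k K χ)

/-! ## §2 Degree `0` and top degree -/

section Extreme

variable {n : ℕ} {X : SchemeOver k}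

/-- **`Γ_k` acts trivially on `H⁰(X)`** for `X` smooth projective (`H⁰(X) = K · 1` consists of
algebraic classes, which are invariant). [cite: Tate1994, §1] -/
theorem ρ_zero_eq_one (hX : IsSmoothProjective n X) (g : Field.absoluteGaloisGroup k) :
    E.ρ X 0 g = 1 := by
  refine LinearMap.ext fun x ↦ ?_
  have h := E.ρTwist_zero_apply hX g x
  rwa [ρTwist_apply, Nat.cast_zero, zpow_zero, one_smul] at h

/-- `Γ_k` acts semisimply on `H⁰(X)`. [cite: Kahn2020, §6.14 SS^i(X, l)] -/
theorem isSemisimple_ρ_zero (hX : IsSmoothProjective n X) (g : Field.absoluteGaloisGroup k) :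
    Module.End.IsSemisimple (E.ρ X 0 g) := by
  rw [E.ρ_zero_eq_one hX g]
  refine Module.End.isSemisimple_iff.mpr fun p _ ↦ ?_
  obtain ⟨q, hq⟩ := p.exists_isCompl
  exact ⟨q, (Module.End.mem_invtSubmodule _).mpr fun x hx ↦ by simpa using hx, hq⟩

/-- **`Γ_k` acts on `H^{2n}(X)` (`n = dim X`) through the character `χ^{-n}`**: `ρ(g) = χ(g)^{-n} · 1`
(the trace `H^{2n}(X)(n) → K` is an invariant isomorphism). [cite: Tate1994, §1] -/
theorem ρ_top_eq_smul_one (hX : IsSmoothProjective n X) (g : Field.absoluteGaloisGroup k) :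
    E.ρ X (2 * n) g = ((χ g : K) ^ (n : ℤ))⁻¹ • (1 : Module.End K (E.obj X (2 * n))) := by
  refine LinearMap.ext fun x ↦ ?_
  have h := E.ρTwist_top_apply hX g x
  rw [ρTwist_apply] at h
  rw [LinearMap.smul_apply, Module.End.one_apply]
  conv_rhs => rw [← h]
  rw [smul_smul, inv_mul_cancel₀ (zpow_ne_zero _ (χ g).ne_zero), one_smul]

/-- `Γ_k` acts semisimply on `H^{2 dim X}(X)`. [cite: Kahn2020, §6.14 SS^i(X, l)] -/
theorem isSemisimple_ρ_top (hX : IsSmoothProjective n X) (g : Field.absoluteGaloisGroup k) :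
    Module.End.IsSemisimple (E.ρ X (2 * n) g) := by
  rw [E.ρ_top_eq_smul_one hX g]
  refine Module.End.IsSemisimple_smul _ (Module.End.isSemisimple_iff.mpr fun p _ ↦ ?_)
  obtain ⟨q, hq⟩ := p.exists_isCompl
  exact ⟨q, (Module.End.mem_invtSubmodule _).mpr fun x hx ↦ by simpa using hx, hq⟩

end Extreme

/-! ## §3 Abelian varieties: generation by `H¹` -/

section AbelianVariety

variable {g : ℕ} (A : AbelianVariety k)

/-- **The cup product `H¹(A) ⊗ Hᵉ(A) → Hᵉ⁺¹(A)` intertwines `ρ(σ) ⊗ ρ(σ)` with `ρ(σ)`**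
(equivariance of cup products, axiom `cup_ρ`). [cite: Tate1994, §1] -/
theorem ρ_comp_mulOne (hA : IsSmoothProjective g A.X) (e : ℕ) (σ : Field.absoluteGaloisGroup k) :
    E.mulOne A e ∘ₗ TensorProduct.map (E.ρ A.X 1 σ) (E.ρ A.X e σ) =
      E.ρ A.X (e + 1) σ ∘ₗ E.mulOne A e := by
  refine TensorProduct.ext' fun v y ↦ ?_
  simp only [LinearMap.comp_apply, TensorProduct.map_tmul, WeilCohomology.mulOne_tmul]
  exact (E.cup_ρ hA (Nat.add_comm 1 e) σ v y).symm

/-- **`SS(H¹(A)) ∧ SS(Hᵉ(A)) ⟹ SS(Hᵉ⁺¹(A))`**: `Hᵉ⁺¹(A)` is an equivariant quotient of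
`H¹(A) ⊗ Hᵉ(A)` (surjectivity of the cup product on an abelian variety, `range_mulOne`), on which
`ρ(σ) ⊗ ρ(σ)` is semisimple. [cite: Milne2007TateFiniteFieldsAIM, §1 p. 3 («It follows that they act semisimply on all the cohomology groups Hⁱ(A) ≃ ⋀ⁱH¹(A)»)] -/
theorem isSemisimple_ρ_succ_abelianVariety (hA : IsSmoothProjective g A.X)
    (σ : Field.absoluteGaloisGroup k) {e : ℕ} (h1 : Module.End.IsSemisimple (E.ρ A.X 1 σ))
    (he : Module.End.IsSemisimple (E.ρ A.X e σ)) :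
    Module.End.IsSemisimple (E.ρ A.X (e + 1) σ) := by
  haveI := E.finite_obj hA 1
  haveI := E.finite_obj hA e
  obtain ⟨w, hw⟩ := E.exists_pow_ne_zero_of_isSmoothProjective hA
  have hsurj : Function.Surjective (E.mulOne A e) :=
    LinearMap.range_eq_top.mp (E.range_mulOne A hA hw e)
  exact isSemisimple_of_comp_eq_of_surjective (isSemisimple_tensorProductMap h1 he) hsurj
    (E.ρ_comp_mulOne A hA e σ)

/-- **«It follows that they act semisimply on all the cohomology groups `Hⁱ(A)`»**: if `σ ∈ Γ_k`
acts semisimply on `H¹(A)` then it acts semisimply on every `Hᵈ(A)` (induction on `d`, starting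
from the trivial action on `H⁰(A)`). [cite: Milne2007TateFiniteFieldsAIM, §1 p. 3 («It follows that they act semisimply on all the cohomology groups Hⁱ(A) ≃ ⋀ⁱH¹(A)»)] -/
theorem isSemisimple_ρ_abelianVariety_of_one (hA : IsSmoothProjective g A.X)
    (σ : Field.absoluteGaloisGroup k) (h1 : Module.End.IsSemisimple (E.ρ A.X 1 σ)) (d : ℕ) :
    Module.End.IsSemisimple (E.ρ A.X d σ) := by
  induction d with
  | zero => exact E.isSemisimple_ρ_zero hA σ
  | succ d ih => exact E.isSemisimple_ρ_succ_abelianVariety A hA σ h1 ih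

/-- `SS^•(A) ⟺ SS(H¹(A))` for the action of `σ ∈ Γ_k`. [cite: Milne2007TateFiniteFieldsAIM, §1 p. 3] -/
theorem forall_isSemisimple_ρ_abelianVariety_iff (hA : IsSmoothProjective g A.X)
    (σ : Field.absoluteGaloisGroup k) :
    (∀ d, Module.End.IsSemisimple (E.ρ A.X d σ)) ↔ Module.End.IsSemisimple (E.ρ A.X 1 σ) :=
  ⟨fun h ↦ h 1, fun h1 ↦ E.isSemisimple_ρ_abelianVariety_of_one A hA σ h1⟩

/-- **Products of abelian varieties**: `SS(H¹(A)) ∧ SS(H¹(B)) ⟹ SS(Hᵈ(A × B))` for all `d`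
(Künneth, row g38-#2). [cite: Milne2007TateFiniteFieldsAIM, §1 p. 3 and Th. 1.3 (proof: «Künneth formula»)] -/
theorem isSemisimple_ρ_prod_abelianVariety_of_one {g' : ℕ} (B : AbelianVariety k)
    (hA : IsSmoothProjective g A.X) (hB : IsSmoothProjective g' B.X)
    (σ : Field.absoluteGaloisGroup k) (hA1 : Module.End.IsSemisimple (E.ρ A.X 1 σ))
    (hB1 : Module.End.IsSemisimple (E.ρ B.X 1 σ)) (d : ℕ) :
    Module.End.IsSemisimple (E.ρ (A.X ⊗ B.X) d σ) :=
  E.isSemisimple_ρ_tensor_of_forall hA hB σ (E.isSemisimple_ρ_abelianVariety_of_one A hA σ hA1)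
    (E.isSemisimple_ρ_abelianVariety_of_one B hB σ hB1) d

/-- `SS(H¹(A)) ⟹ S` for every `σ ∈ Γ_k` and every twist on every `Hⁱ(A)`:
`Ker(χ(σ)ʲ ρ(σ) − 1) ∩ range = 0`. [cite: Milne2007TateFiniteFieldsAIM, §1 p. 3 («In particular, Conjecture S(X) holds when X is an abelian variety»)] -/
theorem ker_inf_range_eq_bot_ρ_abelianVariety_of_one (hA : IsSmoothProjective g A.X)
    (σ : Field.absoluteGaloisGroup k) (h1 : Module.End.IsSemisimple (E.ρ A.X 1 σ)) (i : ℕ) (j : ℤ) :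
    LinearMap.ker (E.ρTwist A.X i j σ - 1) ⊓ LinearMap.range (E.ρTwist A.X i j σ - 1) = ⊥ :=
  E.ker_inf_range_eq_bot_of_isSemisimple_ρ A.X i j σ
    (E.isSemisimple_ρ_abelianVariety_of_one A hA σ h1 i)

end AbelianVariety

/-! ## §4 The Frobenius of an abelian variety over a finite field -/

section Frobenius

variable [Finite k] {g : ℕ} (A : AbelianVariety k)

/-- **Milne 2007 §1: `SS(H¹(A)) ⟹` the Frobenius map acts semisimply on all of `H^*(A)`.**
[cite: Milne2007TateFiniteFieldsAIM, §1 p. 3 («It follows that they act semisimply on all the cohomology groups Hⁱ(A) ≃ ⋀ⁱH¹(A)»)] -/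
theorem isSemisimple_frobAction_abelianVariety_of_one (hA : IsSmoothProjective g A.X)
    (h1 : Module.End.IsSemisimple (E.frobAction A.X 1)) (d : ℕ) :
    Module.End.IsSemisimple (E.frobAction A.X d) :=
  E.isSemisimple_ρ_abelianVariety_of_one A hA (geomFrob k) h1 d

/-- `SS(H¹(A)) ⟹` Frobenius semisimple on all of `H^*(A × A)`.
[cite: Milne2007TateFiniteFieldsAIM, §1 p. 3 and Th. 1.3 (proof)] [cite: Kahn2020, §6.14 Th. 6.54] -/
theorem isSemisimple_frobAction_self_product_abelianVariety_of_one (hA : IsSmoothProjective g A.X)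
    (h1 : Module.End.IsSemisimple (E.frobAction A.X 1)) (d : ℕ) :
    Module.End.IsSemisimple (E.frobAction (A.X ⊗ A.X) d) :=
  E.isSemisimple_ρ_prod_abelianVariety_of_one A A hA hA (geomFrob k) h1 h1 d

/-- **«In particular, Conjecture `S(X)` holds when `X` is an abelian variety»** (given Weil's
`SS(H¹(A))`): `S` for every twisted Frobenius `χ(F)ʲ F` on every `Hⁱ(A)`; for `(i, j) = (2r, r)`
this is `S^r(A)` of `TateConjectureStrongFormFiniteField`. [cite: Milne2007TateFiniteFieldsAIM, §1 p. 3 («In particular, Conjecture S(X) holds when X is an abelian variety»)] -/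
theorem ker_inf_range_eq_bot_abelianVariety_of_one (hA : IsSmoothProjective g A.X)
    (h1 : Module.End.IsSemisimple (E.frobAction A.X 1)) (i : ℕ) (j : ℤ) :
    LinearMap.ker (E.ρTwist A.X i j (geomFrob k) - 1) ⊓
      LinearMap.range (E.ρTwist A.X i j (geomFrob k) - 1) = ⊥ :=
  E.ker_inf_range_eq_bot_ρ_abelianVariety_of_one A hA (geomFrob k) h1 i j

/-- `S^r(A)` in the codimension indexing, given `SS(H¹(A))`. [cite: Milne2007TateFiniteFieldsAIM, §1 p. 3] -/
theorem ker_inf_range_eq_bot_codim_abelianVariety_of_one (hA : IsSmoothProjective g A.X)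
    (h1 : Module.End.IsSemisimple (E.frobAction A.X 1)) (r : ℕ) :
    LinearMap.ker (E.ρTwist A.X (2 * r) r (geomFrob k) - 1) ⊓
      LinearMap.range (E.ρTwist A.X (2 * r) r (geomFrob k) - 1) = ⊥ :=
  E.ker_inf_range_eq_bot_abelianVariety_of_one A hA h1 (2 * r) r

/-- `S` for every twisted Frobenius on `H^*(A × A)`, given `SS(H¹(A))`.
[cite: Milne2007TateFiniteFieldsAIM, §1 p. 3 and Th. 1.3] [cite: Kahn2020, §6.14 Th. 6.54] -/
theorem ker_inf_range_eq_bot_self_product_abelianVariety_of_one (hA : IsSmoothProjective g A.X)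
    (h1 : Module.End.IsSemisimple (E.frobAction A.X 1)) (e : ℕ) (j : ℤ) :
    LinearMap.ker (E.ρTwist (A.X ⊗ A.X) e j (geomFrob k) - 1) ⊓
      LinearMap.range (E.ρTwist (A.X ⊗ A.X) e j (geomFrob k) - 1) = ⊥ :=
  have h := E.isSemisimple_frobAction_abelianVariety_of_one A hA h1
  E.ker_inf_range_eq_bot_tensor_of_isSemisimple_frobAction hA hA h h e j

/-- **The strong Tate condition `S^g(A × A)` of Kahn's Th. 6.54 ∕ Milne's Th. 1.3 holds for an
abelian variety with `SS(H¹(A))`.** [cite: Kahn2020, §6.14 Th. 6.54] [cite: Milne2007TateFiniteFieldsAIM, Th. 1.3] -/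
theorem self_product_strongTate_abelianVariety_of_one (hA : IsSmoothProjective g A.X)
    (h1 : Module.End.IsSemisimple (E.frobAction A.X 1)) :
    LinearMap.ker (E.ρTwist (A.X ⊗ A.X) (2 * g) g (geomFrob k) - 1) ⊓
      LinearMap.range (E.ρTwist (A.X ⊗ A.X) (2 * g) g (geomFrob k) - 1) = ⊥ :=
  E.ker_inf_range_eq_bot_self_product_of_isSemisimple_frobAction hA
    (E.isSemisimple_frobAction_abelianVariety_of_one A hA h1)

/-- Under `SS(H¹(A))` Tate's theorem for `A` in codimension `r` reads: `dim_K K·Aʳ(A) =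
dim H^{2r}(A)(r)_1 ⟺ K·Aʳ(A) = Ker(φ_r − 1)` (Milne 1986 Prop. 8.2 with its `SS` conjunct
discharged, row g38-#3). [cite: Milne1986ValuesZetaFunctionsFiniteFields, §8 Prop. 8.2]
[cite: Milne2007TateFiniteFieldsAIM, §1 p. 3] -/
theorem finrank_algebraicClasses_eq_iff_abelianVariety_of_one (hA : IsSmoothProjective g A.X)
    (h1 : Module.End.IsSemisimple (E.frobAction A.X 1)) (r : ℕ) :
    Module.finrank K (E.algebraicClasses A.X r) =
        Module.finrank K (Module.End.maxGenEigenspace (E.ρTwist A.X (2 * r) r (geomFrob k)) 1) ↔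
      E.algebraicClasses A.X r = LinearMap.ker (E.ρTwist A.X (2 * r) r (geomFrob k) - 1) :=
  E.finrank_algebraicClasses_eq_iff_of_isSemisimple_frobAction hA r
    (E.isSemisimple_frobAction_abelianVariety_of_one A hA h1 (2 * r))

end Frobenius

end GaloisWeilCohomology

end Literature.AlgebraicGeometry.Motives

end
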